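import Summits.QuantumFields.YangMills.Theorems.ToronSmallBallOwnAxisShiftTranslate
import Summits.QuantumFields.YangMills.Theorems.ToronSmallBallOwnAxisShiftCost
import Summits.QuantumFields.YangMills.Theorems.ToronSmallBallOwnAxisShiftGood
import Summits.QuantumFields.YangMills.Theorems.QuantileBitPuritySectorGoodReduction
import Literature.MathematicalPhysics.QuantumFieldTheory.Balaban1983to89.T4HaarSU2Translate
import HarnessLib

/-!
# The own-axis sheet shift: one shift dominates the off-core strip by a disjoint image (periodic sector)

Support module (`--supports` stmt-QuantumFields-24089, `ToronSmallBall.PeriodicOffCoreStripWindowDeep`; seat ym-dw-p1 g15).  On the ring of `n+1` slices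
closed through the untwisted seam consider, inside the good-field event `goodEvent n 0 s t`, the OFF-CORE STRIP of the slice-`0` holonomies
`A = {|polDist U₀ − polDist(S U₀)| ≤ w, c₀ < polDist U₀}` split by the hemisphere of the `x`-holonomy through the origin (`re q(P) ≥ 0`, resp. `≤ 0`).
For a shift angle `θ` with `|θ| ≤ σ/2`, where `σ ≤ c₀/2 − 2L²√s − nLt` is the non-centrality floor, the own-axis shift of every slice maps the lower
half `A₊` (with `0 ≤ θ ≤ π/2`) into the explicit event
`B₊(θ) = {0 ≤ r − θ ≤ π/2, |√(4−4|cos(r−θ)|) − polDist(S U₀)| ≤ w, c₀ < √(4−4|cos(r−θ)|)}`, `r = arccos(re q(polyX U₀))`,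
and the upper half `A₋` (with `−π/2 ≤ θ ≤ 0`) into the mirror event `B₋(θ)`; and

★ `sectorWeight_stripLower_le` / `sectorWeight_stripUpper_le`:
`W₀(𝟙_{A±}) ≤ exp(β(n+1)(#P·b_P + #E·b_T)) · ((1 − |θ|/σ)⁻²)^{#plane·(n+1)} · W₀(𝟙_{B±(θ)})`
(`b_P, b_T` the second-order costs of `ToronSmallBallOwnAxisShiftCost` with `ε = √s`, `τ = t`).  The events `B±(kθ')`, `k = 1, 2, …`, are pairwise
disjoint as soon as `θ' ≥ 5w` (`B_disjoint_lower/upper`, strip separation of `ToronSmallBallOwnAxisShiftAngle`).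

HONEST FRAMING: fixed-lattice inequalities; nothing about infinite volume, the continuum limit or the Clay gap.  No `sorry`, no new axiom, no new
definition.  References: [cite: Luscher1983, §2]; [cite: MontvayMunster1994, (3.145)].
-/

set_option autoImplicit false

noncomputable section

open MeasureTheory Set Function
open scoped BigOperators
open Literature.MathematicalPhysics.QuantumLattice (su2Quat su2Quat_ne_zero norm_su2Quat)
open Literature.MathematicalPhysics.QuantumFieldTheory hiding su2Quat_mul
open Literature.MathematicalPhysics.QuantumFieldTheory.Balaban1983to89.T4HaarSU2ExpChart (expPoint)
open Literature.MathematicalPhysics.QuantumFieldTheory.Balaban1983to89.T4HaarSU2Translate (continuous_su2Quat)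

namespace Summit.QuantumFields.YangMills.Theorems.FemtoTransferGap.OwnAxis

open ClassShift FlatSheet
open Summit.QuantumFields.YangMills.Theorems.FemtoTransferGap.TT

variable {L : ℕ} [NeZero L]

/-! ## §1 The Jacobian constant of the shell `[arcsin σ, π − arcsin σ]` -/

/-- `σ ≤ arcsin σ` for `0 ≤ σ ≤ 1`. [folklore] -/
theorem le_arcsin_self {σ : ℝ} (h0 : 0 ≤ σ) (h1 : σ ≤ 1) : σ ≤ Real.arcsin σ := by
  have h := Real.sin_le (Real.arcsin_nonneg.2 h0)
  rw [Real.sin_arcsin (by linarith) h1] at h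
  exact h

/-- On the shell `[arcsin σ, π − arcsin σ]` the sine is at least `σ`. [folklore] -/
theorem le_sin_of_mem_shell {σ r : ℝ} (h0 : 0 ≤ σ) (h1 : σ ≤ 1) (ha : Real.arcsin σ ≤ r) (hb : r ≤ Real.pi - Real.arcsin σ) : σ ≤ Real.sin r := by
  have hσa := Real.sin_arcsin (by linarith : (-1 : ℝ) ≤ σ) h1
  by_cases hr : r ≤ Real.pi / 2
  · rw [← hσa]
    exact Real.sin_le_sin_of_le_of_le_pi_div_two (by linarith [Real.arcsin_nonneg.2 h0, Real.neg_pi_div_two_le_arcsin σ]) hr ha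
  · rw [← Real.sin_pi_sub, ← hσa]
    exact Real.sin_le_sin_of_le_of_le_pi_div_two (by linarith [Real.neg_pi_div_two_le_arcsin σ]) (by rw [not_le] at hr; linarith) (by linarith)

/-- ★ **The one-link Jacobian constant on the shell**: for `|θ| ≤ σ/2`, `σ ∈ (0,1]`, and `r ∈ [arcsin σ, π − arcsin σ]`,
`sin² r ≤ (1 − |θ|/σ)⁻² · sin²(r + θ)`. [folklore] -/
theorem sin_sq_le_rho_mul {σ θ r : ℝ} (hσ : 0 < σ) (h1 : σ ≤ 1) (hθ : |θ| ≤ σ / 2) (ha : Real.arcsin σ ≤ r) (hb : r ≤ Real.pi - Real.arcsin σ) :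
    Real.sin r ^ 2 ≤ ((1 - |θ| / σ) ^ 2)⁻¹ * Real.sin (r + θ) ^ 2 := by
  have hsr : σ ≤ Real.sin r := le_sin_of_mem_shell hσ.le h1 ha hb
  have hsr0 : 0 < Real.sin r := hσ.trans_le hsr
  have hlip : |Real.sin (r + θ) - Real.sin r| ≤ |θ| := by
    have := Real.abs_sin_sub_sin_le (r + θ) r; rwa [add_sub_cancel_left] at this
  have hlow : Real.sin r * (1 - |θ| / σ) ≤ Real.sin (r + θ) := by
    have h2 : Real.sin r - |θ| ≤ Real.sin (r + θ) := by linarith [(abs_le.1 hlip).1]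
    have h3 : Real.sin r * (|θ| / σ) ≥ |θ| := by
      rw [ge_iff_le, ← div_le_iff₀' (by positivity)]
      · exact div_le_div_of_nonneg_left (abs_nonneg _) hσ hsr
    nlinarith
  have hk : 0 < 1 - |θ| / σ := by
    have : |θ| / σ ≤ 1 / 2 := by rw [div_le_iff₀ hσ]; linarith
    linarith
  have hpos : 0 < (1 - |θ| / σ) ^ 2 := by positivity
  rw [← div_eq_inv_mul, le_div_iff₀ hpos]
  have h0 : 0 ≤ Real.sin r * (1 - |θ| / σ) := by positivity
  calc Real.sin r ^ 2 * (1 - |θ| / σ) ^ 2 = (Real.sin r * (1 - |θ| / σ)) ^ 2 := by ring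
    _ ≤ Real.sin (r + θ) ^ 2 := pow_le_pow_left₀ h0 hlow 2

/-! ## §2 Measurability of the events -/

omit [NeZero L] in
/-- `U ↦ re q(polyX U)` is measurable. [folklore] -/
theorem measurable_re_su2Quat_polyX : Measurable fun U : GaugeConfig 3 L SU2 => (su2Quat (polyX U)).re := by
  have h1 : Measurable fun U : GaugeConfig 3 L SU2 => polyX U := by
    have e : (fun U : GaugeConfig 3 L SU2 => polyX U) = fun U => lineHolonomy U 0 L 0 := funext fun U => polyX_eq_lineHolonomy U
    rw [e]; exact measurable_lineHolonomy 0 L 0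
  exact (Quaternion.continuous_re.comp continuous_su2Quat).measurable.comp h1

/-- The off-core strip of slice `0` is measurable. [folklore] -/
theorem measurableSet_strip' (w c₀ : ℝ) :
    MeasurableSet {U : GaugeConfig 3 L SU2 | |polDist U - polDist (configPerm (Equiv.swap (0 : Fin 3) 1) U)| ≤ w ∧ c₀ < polDist U} := by
  have h1 : Measurable fun U : GaugeConfig 3 L SU2 => |polDist U - polDist (configPerm (Equiv.swap (0 : Fin 3) 1) U)| :=
    (measurable_polDist.sub (measurable_polDist.comp (configPerm (Equiv.swap (0 : Fin 3) 1)).measurable)).abs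
  rw [Set.setOf_and]
  exact (measurableSet_le h1 measurable_const).inter (measurableSet_lt measurable_const measurable_polDist)

/-! ## §3 The lower hemisphere: domination by the shifted image -/

/-- ★ **Lower-hemisphere domination.**  See the module docstring; `θ ∈ [0, π/2]`, `|θ| ≤ σ/2`, `0 < σ ≤ 1`, `σ ≤ c₀/2 − 2L²√s − nLt`, `β ≥ 0`.
[cite: Luscher1983, §2] [cite: MontvayMunster1994, (3.145)] -/
theorem sectorWeight_stripLower_le {β : ℝ} (hβ : 0 ≤ β) (n : ℕ) {s t w c₀ σ θ : ℝ} (hσ : 0 < σ) (hσ1 : σ ≤ 1)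
    (hσle : σ ≤ c₀ / 2 - 2 * (L * (L * Real.sqrt s)) - n * (L * t)) (hθ0 : 0 ≤ θ) (hθσ : θ ≤ σ / 2) (hθπ : θ ≤ Real.pi / 2) :
    sectorWeight β n (fun _ => false) (fun Us g =>
        {p : (Site 3 L → SU2) × (Fin (n + 1) → GaugeConfig 3 L SU2) |
          p ∈ goodEvent n (fun _ => false) s t ∧
          (|polDist (p.2 0) - polDist (configPerm (Equiv.swap (0 : Fin 3) 1) (p.2 0))| ≤ w ∧ c₀ < polDist (p.2 0)) ∧
          0 ≤ (su2Quat (polyX (p.2 0))).re}.indicator (fun _ => (1 : ℝ)) (g, Us)) ≤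
      Real.exp (β * ((n + 1 : ℕ) * (Fintype.card (Plaquette 3 L) * ((|θ| * (2 * (L * Real.sqrt s) / σ)) ^ 2 + 2 * (|θ| * (2 * (L * Real.sqrt s) / σ)) * Real.sqrt s) +
          Fintype.card (Edge 3 L) * ((|θ| * (2 * (L * t) / σ)) ^ 2 + 2 * (|θ| * (2 * (L * t) / σ)) * t)))) *
        ((((1 - |θ| / σ) ^ 2)⁻¹) ^ (Finset.univ.filter (fun x : Site 3 L => x 0 = 0)).card) ^ (n + 1) *
      sectorWeight β n (fun _ => false) (fun Us g =>
        {p : (Site 3 L → SU2) × (Fin (n + 1) → GaugeConfig 3 L SU2) |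
          (0 ≤ Real.arccos (su2Quat (polyX (p.2 0))).re - θ ∧ Real.arccos (su2Quat (polyX (p.2 0))).re - θ ≤ Real.pi / 2) ∧
          |Real.sqrt (4 - 4 * |Real.cos (Real.arccos (su2Quat (polyX (p.2 0))).re - θ)|) - polDist (configPerm (Equiv.swap (0 : Fin 3) 1) (p.2 0))| ≤ w ∧
          c₀ < Real.sqrt (4 - 4 * |Real.cos (Real.arccos (su2Quat (polyX (p.2 0))).re - θ)|)}.indicator (fun _ => (1 : ℝ)) (g, Us)) := by
  have hθabs : |θ| = θ := abs_of_nonneg hθ0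
  have hθ' : |θ| ≤ σ / 2 := by rw [hθabs]; exact hθσ
  -- shell parameters
  have ha : 0 < Real.arcsin σ := Real.arcsin_pos.2 hσ
  have hσa : σ ≤ Real.arcsin σ := le_arcsin_self hσ.le hσ1
  have hbπ : Real.pi - Real.arcsin σ < Real.pi := by linarith
  have haθ : 0 < Real.arcsin σ + θ := by linarith
  have hbθ : Real.pi - Real.arcsin σ + θ < Real.pi := by linarith
  have hρ : 0 ≤ ((1 - |θ| / σ) ^ 2)⁻¹ := by positivity
  have hsin : ∀ r : ℝ, Real.arcsin σ ≤ r → r ≤ Real.pi - Real.arcsin σ → Real.sin r ^ 2 ≤ ((1 - |θ| / σ) ^ 2)⁻¹ * Real.sin (r + θ) ^ 2 :=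
    fun r hr1 hr2 => sin_sq_le_rho_mul hσ hσ1 hθ' hr1 hr2
  -- measurability of the two events
  have hproj : Measurable fun p : (Site 3 L → SU2) × (Fin (n + 1) → GaugeConfig 3 L SU2) => p.2 0 := (measurable_pi_apply 0).comp measurable_snd
  have hA : MeasurableSet {p : (Site 3 L → SU2) × (Fin (n + 1) → GaugeConfig 3 L SU2) |
      p ∈ goodEvent n (fun _ => false) s t ∧
      (|polDist (p.2 0) - polDist (configPerm (Equiv.swap (0 : Fin 3) 1) (p.2 0))| ≤ w ∧ c₀ < polDist (p.2 0)) ∧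
      0 ≤ (su2Quat (polyX (p.2 0))).re} := by
    have h1 : MeasurableSet {p : (Site 3 L → SU2) × (Fin (n + 1) → GaugeConfig 3 L SU2) | p ∈ goodEvent n (fun _ => false) s t} :=
      measurableSet_goodEvent (L := L) n _ s t
    have h2 : MeasurableSet {p : (Site 3 L → SU2) × (Fin (n + 1) → GaugeConfig 3 L SU2) |
        |polDist (p.2 0) - polDist (configPerm (Equiv.swap (0 : Fin 3) 1) (p.2 0))| ≤ w ∧ c₀ < polDist (p.2 0)} := hproj (measurableSet_strip' (L := L) w c₀)
    have h3 : MeasurableSet {p : (Site 3 L → SU2) × (Fin (n + 1) → GaugeConfig 3 L SU2) | 0 ≤ (su2Quat (polyX (p.2 0))).re} :=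
      measurableSet_le measurable_const (measurable_re_su2Quat_polyX.comp hproj)
    rw [measurableSet_setOf] at h1 h2 h3 ⊢
    exact h1.and (h2.and h3)
  have hr : Measurable fun p : (Site 3 L → SU2) × (Fin (n + 1) → GaugeConfig 3 L SU2) => Real.arccos (su2Quat (polyX (p.2 0))).re - θ :=
    (Real.continuous_arccos.measurable.comp (measurable_re_su2Quat_polyX.comp hproj)).sub measurable_const
  have hg : Measurable fun p : (Site 3 L → SU2) × (Fin (n + 1) → GaugeConfig 3 L SU2) =>
      Real.sqrt (4 - 4 * |Real.cos (Real.arccos (su2Quat (polyX (p.2 0))).re - θ)|) :=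
    (measurable_const.sub ((Real.continuous_cos.measurable.comp hr).abs.const_mul _)).sqrt
  have hpdS : Measurable fun p : (Site 3 L → SU2) × (Fin (n + 1) → GaugeConfig 3 L SU2) => polDist (configPerm (Equiv.swap (0 : Fin 3) 1) (p.2 0)) :=
    (measurable_polDist.comp (configPerm (Equiv.swap (0 : Fin 3) 1)).measurable).comp hproj
  have hB : MeasurableSet {p : (Site 3 L → SU2) × (Fin (n + 1) → GaugeConfig 3 L SU2) |
      (0 ≤ Real.arccos (su2Quat (polyX (p.2 0))).re - θ ∧ Real.arccos (su2Quat (polyX (p.2 0))).re - θ ≤ Real.pi / 2) ∧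
      |Real.sqrt (4 - 4 * |Real.cos (Real.arccos (su2Quat (polyX (p.2 0))).re - θ)|) - polDist (configPerm (Equiv.swap (0 : Fin 3) 1) (p.2 0))| ≤ w ∧
      c₀ < Real.sqrt (4 - 4 * |Real.cos (Real.arccos (su2Quat (polyX (p.2 0))).re - θ)|)} := by
    have h1 := measurableSet_le (measurable_const (a := (0 : ℝ))) hr
    have h2 := measurableSet_le hr (measurable_const (a := Real.pi / 2))
    have h3 := measurableSet_le ((hg.sub hpdS).abs) (measurable_const (a := w))
    have h4 := measurableSet_lt (measurable_const (a := c₀)) hg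
    rw [measurableSet_setOf] at h1 h2 h3 h4 ⊢
    exact (h1.and h2).and (h3.and h4)
  -- the translate lemma with Jacobian
  refine sectorWeight_indicator_le_of_ownShift (L := L) β n (fun _ => false) ha hbπ haθ hbθ hρ hsin hA hB ?_ ?_ (Real.exp_pos _).le ?_
  · -- (i) shell: every plane line of every slice
    rintro p ⟨hgood, ⟨-, hcore⟩, -⟩ k x hx
    exact lineHolonomy_mem_shell_of_goodEvent hσ hgood (by linarith) k hx
  · -- (ii) the image lands in `B₊(θ)`
    rintro p ⟨hgood, ⟨hstrip, hcore⟩, hre⟩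
    have hfloor : σ ≤ ‖imVec (su2Quat (polyX (p.2 0)))‖ := by
      rw [polyX_eq_lineHolonomy]
      exact floor_of_goodEvent hgood (by linarith) 0 0 (by simp)
    have hnc : imVec (su2Quat (polyX (p.2 0))) ≠ 0 := fun h => by rw [h, norm_zero] at hfloor; linarith
    set r := Real.arccos (su2Quat (polyX (p.2 0))).re with hrdef
    have hr0 : 0 ≤ r := Real.arccos_nonneg _
    have hrπ2 : r ≤ Real.pi / 2 := Real.arccos_le_pi_div_two.2 hre
    simp only [Set.mem_setOf_eq]
    rw [polyX_ownShift, arccos_re_classShift hnc (by linarith) (by linarith [Real.pi_pos]), polDist_swap_ownShift,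
      show Real.arccos (su2Quat (polyX (p.2 0))).re + θ - θ = r by rw [hrdef]; ring, ← vacDist_eq_sqrt_angle]
    exact ⟨⟨hr0, hrπ2⟩, hstrip, hcore⟩
  · -- (iii) the cost
    rintro p ⟨hgood, ⟨-, hcore⟩, -⟩
    obtain ⟨hP, hTi, hTs⟩ := goodEvent_dictionary hgood
    have hNC : ∀ (k : Fin (n + 1)) (y : Site 3 L), y 0 = 0 → σ ≤ ‖imVec (su2Quat (lineHolonomy (p.2 k) 0 L y))‖ :=
      fun k y hy => floor_of_goodEvent hgood (by linarith) k y hy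
    exact seamDensity_le_exp_mul_ownShift hβ θ hσ p.2 p.1 hNC hP hTi hTs

/-! ## §4 The upper hemisphere: domination by the image shifted towards the equator -/

/-- ★ **Upper-hemisphere domination** (shift `θ ∈ [−π/2, 0]`, `|θ| ≤ σ/2`). [cite: Luscher1983, §2] [cite: MontvayMunster1994, (3.145)] -/
theorem sectorWeight_stripUpper_le {β : ℝ} (hβ : 0 ≤ β) (n : ℕ) {s t w c₀ σ θ : ℝ} (hσ : 0 < σ) (hσ1 : σ ≤ 1)
    (hσle : σ ≤ c₀ / 2 - 2 * (L * (L * Real.sqrt s)) - n * (L * t)) (hθ0 : θ ≤ 0) (hθσ : -θ ≤ σ / 2) (hθπ : -θ ≤ Real.pi / 2) :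
    sectorWeight β n (fun _ => false) (fun Us g =>
        {p : (Site 3 L → SU2) × (Fin (n + 1) → GaugeConfig 3 L SU2) |
          p ∈ goodEvent n (fun _ => false) s t ∧
          (|polDist (p.2 0) - polDist (configPerm (Equiv.swap (0 : Fin 3) 1) (p.2 0))| ≤ w ∧ c₀ < polDist (p.2 0)) ∧
          (su2Quat (polyX (p.2 0))).re ≤ 0}.indicator (fun _ => (1 : ℝ)) (g, Us)) ≤
      Real.exp (β * ((n + 1 : ℕ) * (Fintype.card (Plaquette 3 L) * ((|θ| * (2 * (L * Real.sqrt s) / σ)) ^ 2 + 2 * (|θ| * (2 * (L * Real.sqrt s) / σ)) * Real.sqrt s) +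
          Fintype.card (Edge 3 L) * ((|θ| * (2 * (L * t) / σ)) ^ 2 + 2 * (|θ| * (2 * (L * t) / σ)) * t)))) *
        ((((1 - |θ| / σ) ^ 2)⁻¹) ^ (Finset.univ.filter (fun x : Site 3 L => x 0 = 0)).card) ^ (n + 1) *
      sectorWeight β n (fun _ => false) (fun Us g =>
        {p : (Site 3 L → SU2) × (Fin (n + 1) → GaugeConfig 3 L SU2) |
          (Real.pi / 2 ≤ Real.arccos (su2Quat (polyX (p.2 0))).re - θ ∧ Real.arccos (su2Quat (polyX (p.2 0))).re - θ ≤ Real.pi) ∧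
          |Real.sqrt (4 - 4 * |Real.cos (Real.arccos (su2Quat (polyX (p.2 0))).re - θ)|) - polDist (configPerm (Equiv.swap (0 : Fin 3) 1) (p.2 0))| ≤ w ∧
          c₀ < Real.sqrt (4 - 4 * |Real.cos (Real.arccos (su2Quat (polyX (p.2 0))).re - θ)|)}.indicator (fun _ => (1 : ℝ)) (g, Us)) := by
  have hθabs : |θ| = -θ := abs_of_nonpos hθ0
  have hθ' : |θ| ≤ σ / 2 := by rw [hθabs]; exact hθσ
  have ha : 0 < Real.arcsin σ := Real.arcsin_pos.2 hσ
  have hσa : σ ≤ Real.arcsin σ := le_arcsin_self hσ.le hσ1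
  have hbπ : Real.pi - Real.arcsin σ < Real.pi := by linarith
  have haθ : 0 < Real.arcsin σ + θ := by linarith
  have hbθ : Real.pi - Real.arcsin σ + θ < Real.pi := by linarith
  have hρ : 0 ≤ ((1 - |θ| / σ) ^ 2)⁻¹ := by positivity
  have hsin : ∀ r : ℝ, Real.arcsin σ ≤ r → r ≤ Real.pi - Real.arcsin σ → Real.sin r ^ 2 ≤ ((1 - |θ| / σ) ^ 2)⁻¹ * Real.sin (r + θ) ^ 2 :=
    fun r hr1 hr2 => sin_sq_le_rho_mul hσ hσ1 hθ' hr1 hr2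
  have hproj : Measurable fun p : (Site 3 L → SU2) × (Fin (n + 1) → GaugeConfig 3 L SU2) => p.2 0 := (measurable_pi_apply 0).comp measurable_snd
  have hA : MeasurableSet {p : (Site 3 L → SU2) × (Fin (n + 1) → GaugeConfig 3 L SU2) |
      p ∈ goodEvent n (fun _ => false) s t ∧
      (|polDist (p.2 0) - polDist (configPerm (Equiv.swap (0 : Fin 3) 1) (p.2 0))| ≤ w ∧ c₀ < polDist (p.2 0)) ∧
      (su2Quat (polyX (p.2 0))).re ≤ 0} := by
    have h1 : MeasurableSet {p : (Site 3 L → SU2) × (Fin (n + 1) → GaugeConfig 3 L SU2) | p ∈ goodEvent n (fun _ => false) s t} :=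
      measurableSet_goodEvent (L := L) n _ s t
    have h2 : MeasurableSet {p : (Site 3 L → SU2) × (Fin (n + 1) → GaugeConfig 3 L SU2) |
        |polDist (p.2 0) - polDist (configPerm (Equiv.swap (0 : Fin 3) 1) (p.2 0))| ≤ w ∧ c₀ < polDist (p.2 0)} := hproj (measurableSet_strip' (L := L) w c₀)
    have h3 : MeasurableSet {p : (Site 3 L → SU2) × (Fin (n + 1) → GaugeConfig 3 L SU2) | (su2Quat (polyX (p.2 0))).re ≤ 0} :=
      measurableSet_le (measurable_re_su2Quat_polyX.comp hproj) measurable_const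
    rw [measurableSet_setOf] at h1 h2 h3 ⊢
    exact h1.and (h2.and h3)
  have hr : Measurable fun p : (Site 3 L → SU2) × (Fin (n + 1) → GaugeConfig 3 L SU2) => Real.arccos (su2Quat (polyX (p.2 0))).re - θ :=
    (Real.continuous_arccos.measurable.comp (measurable_re_su2Quat_polyX.comp hproj)).sub measurable_const
  have hg : Measurable fun p : (Site 3 L → SU2) × (Fin (n + 1) → GaugeConfig 3 L SU2) =>
      Real.sqrt (4 - 4 * |Real.cos (Real.arccos (su2Quat (polyX (p.2 0))).re - θ)|) :=
    (measurable_const.sub ((Real.continuous_cos.measurable.comp hr).abs.const_mul _)).sqrt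
  have hpdS : Measurable fun p : (Site 3 L → SU2) × (Fin (n + 1) → GaugeConfig 3 L SU2) => polDist (configPerm (Equiv.swap (0 : Fin 3) 1) (p.2 0)) :=
    (measurable_polDist.comp (configPerm (Equiv.swap (0 : Fin 3) 1)).measurable).comp hproj
  have hB : MeasurableSet {p : (Site 3 L → SU2) × (Fin (n + 1) → GaugeConfig 3 L SU2) |
      (Real.pi / 2 ≤ Real.arccos (su2Quat (polyX (p.2 0))).re - θ ∧ Real.arccos (su2Quat (polyX (p.2 0))).re - θ ≤ Real.pi) ∧
      |Real.sqrt (4 - 4 * |Real.cos (Real.arccos (su2Quat (polyX (p.2 0))).re - θ)|) - polDist (configPerm (Equiv.swap (0 : Fin 3) 1) (p.2 0))| ≤ w ∧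
      c₀ < Real.sqrt (4 - 4 * |Real.cos (Real.arccos (su2Quat (polyX (p.2 0))).re - θ)|)} := by
    have h1 := measurableSet_le (measurable_const (a := Real.pi / 2)) hr
    have h2 := measurableSet_le hr (measurable_const (a := Real.pi))
    have h3 := measurableSet_le ((hg.sub hpdS).abs) (measurable_const (a := w))
    have h4 := measurableSet_lt (measurable_const (a := c₀)) hg
    rw [measurableSet_setOf] at h1 h2 h3 h4 ⊢
    exact (h1.and h2).and (h3.and h4)
  refine sectorWeight_indicator_le_of_ownShift (L := L) β n (fun _ => false) ha hbπ haθ hbθ hρ hsin hA hB ?_ ?_ (Real.exp_pos _).le ?_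
  · rintro p ⟨hgood, ⟨-, hcore⟩, -⟩ k x hx
    exact lineHolonomy_mem_shell_of_goodEvent hσ hgood (by linarith) k hx
  · rintro p ⟨hgood, ⟨hstrip, hcore⟩, hre⟩
    have hfloor : σ ≤ ‖imVec (su2Quat (polyX (p.2 0)))‖ := by
      rw [polyX_eq_lineHolonomy]
      exact floor_of_goodEvent hgood (by linarith) 0 0 (by simp)
    have hnc : imVec (su2Quat (polyX (p.2 0))) ≠ 0 := fun h => by rw [h, norm_zero] at hfloor; linarith
    set r := Real.arccos (su2Quat (polyX (p.2 0))).re with hrdef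
    have hrπ : r ≤ Real.pi := Real.arccos_le_pi _
    have hrπ2 : Real.pi / 2 ≤ r := by
      rw [hrdef]
      rcases hre.lt_or_eq with hlt | heq
      · exact le_of_lt (not_le.1 ((Real.arccos_le_pi_div_two.not).2 (not_le.2 hlt)))
      · rw [heq, Real.arccos_zero]
    simp only [Set.mem_setOf_eq]
    rw [polyX_ownShift, arccos_re_classShift hnc (by linarith) (by linarith), polDist_swap_ownShift,
      show Real.arccos (su2Quat (polyX (p.2 0))).re + θ - θ = r by rw [hrdef]; ring, ← vacDist_eq_sqrt_angle]
    exact ⟨⟨hrπ2, hrπ⟩, hstrip, hcore⟩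
  · rintro p ⟨hgood, ⟨-, hcore⟩, -⟩
    obtain ⟨hP, hTi, hTs⟩ := goodEvent_dictionary hgood
    have hNC : ∀ (k : Fin (n + 1)) (y : Site 3 L), y 0 = 0 → σ ≤ ‖imVec (su2Quat (lineHolonomy (p.2 k) 0 L y))‖ :=
      fun k y hy => floor_of_goodEvent hgood (by linarith) k y hy
    exact seamDensity_le_exp_mul_ownShift hβ θ hσ p.2 p.1 hNC hP hTi hTs

/-! ## §5 The images of different shifts are disjoint -/

omit [NeZero L] in
/-- ★ **Lower images are pairwise disjoint** for shift multiples of `θ' ≥ 5w`, `w ≥ 0`. [folklore] -/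
theorem B_disjoint_lower (n : ℕ) {w c₀ θ' : ℝ} (hw : 0 ≤ w) (hθ' : 5 * w < θ') :
    Pairwise (Function.onFun Disjoint fun k : ℕ =>
      {p : (Site 3 L → SU2) × (Fin (n + 1) → GaugeConfig 3 L SU2) |
        (0 ≤ Real.arccos (su2Quat (polyX (p.2 0))).re - (k + 1 : ℕ) * θ' ∧ Real.arccos (su2Quat (polyX (p.2 0))).re - (k + 1 : ℕ) * θ' ≤ Real.pi / 2) ∧
        |Real.sqrt (4 - 4 * |Real.cos (Real.arccos (su2Quat (polyX (p.2 0))).re - (k + 1 : ℕ) * θ')|) - polDist (configPerm (Equiv.swap (0 : Fin 3) 1) (p.2 0))| ≤ w ∧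
        c₀ < Real.sqrt (4 - 4 * |Real.cos (Real.arccos (su2Quat (polyX (p.2 0))).re - (k + 1 : ℕ) * θ')|)}) := by
  intro j k hjk
  rw [Function.onFun, Set.disjoint_left]
  rintro p ⟨⟨hj0, hj1⟩, hjs, -⟩ ⟨⟨hk0, hk1⟩, hks, -⟩
  set r := Real.arccos (su2Quat (polyX (p.2 0))).re
  have hsep := abs_sub_le_of_strip (Or.inl ⟨hj0, hj1, hk0, hk1⟩) hjs hks
  have hdiff : |(r - (j + 1 : ℕ) * θ') - (r - (k + 1 : ℕ) * θ')| = |((k : ℝ) - j)| * θ' := by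
    have hθpos : 0 < θ' := by linarith
    rw [show (r - (j + 1 : ℕ) * θ') - (r - (k + 1 : ℕ) * θ') = ((k : ℝ) - j) * θ' by push_cast; ring, abs_mul, abs_of_pos hθpos]
  rw [hdiff] at hsep
  have hone : (1 : ℝ) ≤ |((k : ℝ) - j)| := by
    have : (1 : ℤ) ≤ |((k : ℤ) - j)| := Int.one_le_abs (by omega)
    have h2 : |((k : ℝ) - j)| = (|((k : ℤ) - j)| : ℤ) := by push_cast; rfl
    rw [h2]; exact_mod_cast this
  nlinarith

omit [NeZero L] in
/-- ★ **Upper images are pairwise disjoint** for shift multiples of `θ' ≥ 5w` (shifts `−(k+1)θ'`). [folklore] -/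
theorem B_disjoint_upper (n : ℕ) {w c₀ θ' : ℝ} (hw : 0 ≤ w) (hθ' : 5 * w < θ') :
    Pairwise (Function.onFun Disjoint fun k : ℕ =>
      {p : (Site 3 L → SU2) × (Fin (n + 1) → GaugeConfig 3 L SU2) |
        (Real.pi / 2 ≤ Real.arccos (su2Quat (polyX (p.2 0))).re - (-((k + 1 : ℕ) * θ')) ∧ Real.arccos (su2Quat (polyX (p.2 0))).re - (-((k + 1 : ℕ) * θ')) ≤ Real.pi) ∧
        |Real.sqrt (4 - 4 * |Real.cos (Real.arccos (su2Quat (polyX (p.2 0))).re - (-((k + 1 : ℕ) * θ')))|) - polDist (configPerm (Equiv.swap (0 : Fin 3) 1) (p.2 0))| ≤ w ∧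
        c₀ < Real.sqrt (4 - 4 * |Real.cos (Real.arccos (su2Quat (polyX (p.2 0))).re - (-((k + 1 : ℕ) * θ')))|)}) := by
  intro j k hjk
  rw [Function.onFun, Set.disjoint_left]
  rintro p ⟨⟨hj0, hj1⟩, hjs, -⟩ ⟨⟨hk0, hk1⟩, hks, -⟩
  set r := Real.arccos (su2Quat (polyX (p.2 0))).re
  have hsep := abs_sub_le_of_strip (Or.inr ⟨hj0, hj1, hk0, hk1⟩) hjs hks
  have hdiff : |(r - -((j + 1 : ℕ) * θ')) - (r - -((k + 1 : ℕ) * θ'))| = |((j : ℝ) - k)| * θ' := by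
    have hθpos : 0 < θ' := by linarith
    rw [show (r - -((j + 1 : ℕ) * θ')) - (r - -((k + 1 : ℕ) * θ')) = ((j : ℝ) - k) * θ' by push_cast; ring, abs_mul, abs_of_pos hθpos]
  rw [hdiff] at hsep
  have hone : (1 : ℝ) ≤ |((j : ℝ) - k)| := by
    have : (1 : ℤ) ≤ |((j : ℤ) - k)| := Int.one_le_abs (by omega)
    have h2 : |((j : ℝ) - k)| = (|((j : ℤ) - k)| : ℤ) := by push_cast; rfl
    rw [h2]; exact_mod_cast this
  nlinarith

end Summit.QuantumFields.YangMills.Theorems.FemtoTransferGap.OwnAxis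

end
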